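import Summits.KontsevichZagierPeriods.KontsevichZagierPeriods.Theses.FurushoPentagon
import Summits.KontsevichZagierPeriods.KontsevichZagierPeriods.Theorems.FurushoPentagonReducedPeriodRingLinStokesSymDefs
import Summits.KontsevichZagierPeriods.KontsevichZagierPeriods.Theorems.FurushoPentagonSectorToKernelStokesSpanCalibration
import Literature.NumberTheory.Transcendental.KZCubicalCalculus
import Literature.NumberTheory.Transcendental.KZProductIdeal
import Literature.NumberTheory.Transcendental.SemialgebraicMapsProofs
import Literature.NumberTheory.Transcendental.SemialgebraicLineDeriv
import Mathlib.Analysis.Calculus.Deriv.Pi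
import Mathlib.Analysis.Calculus.Deriv.Mul
import Mathlib.Analysis.Calculus.Deriv.Comp

/-!
# `ReducedPeriodRing`, line `lin-stokes-sym`: dyadic subdivision from Lin + StokesLast + Sym

Crux `FurushoPentagon.ReducedPeriodRing` (stmt-KontsevichZagierPeriods-3929), line `lin-stokes-sym`,
stub `stub_subdivGeneration`: every dyadic subdivision generator `[r] − [r₁] − [r₂]` of the cubical
Kontsevich–Zagier calculus (`KZ.cubicalSubdivGens`: tame cubes, `r₁ = ½ r(· with xᵢ ↦ xᵢ/2)`,
`r₂ = ½ r(· with xᵢ ↦ (1 + xᵢ)/2)` on `[0,1]ⁿ`) lies in Ayoub's relation module with symmetries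
`linStokesSymIdeal = closure (Lin ∪ StokesLast ∪ Sym)` (`…ReducedPeriodRingLinStokesSymDefs`) — the
very relation that killed the symmetry-free line (`ReducedPeriodRing/Negative/KernelControlModPi`).

Proof (`SubdivGeneration.of_sub_of_sub_of_mem`). With `g = r.integrand`, `u = xᵢ`, a new LAST
coordinate `s ∈ [0,1]`, `A = (x with xᵢ ↦ (s/2)u)`, `B = (x with xᵢ ↦ s/2 + (1 − s/2)u)`, the
homotopy `Ψ = (s/2) g(A) + (1 − s/2) g(B) − g(x)` (notation `Ψ[n, g, i]`) has `Ψ|_{s=0} = 0`,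
`Ψ|_{s=1} = r₁ + r₂ − r`, and the potential `V = ½ (u g(A) − (u − 1) g(B))` (`V[n, g, i]`) has
`V|_{u=1} = V|_{u=0}` and `∂ᵤV = ∂ₛΨ` (`∂ᵤ(u g(tu)) = ∂ₜ(t g(tu))`,
`∂ᵤ((u − 1) g(t + (1 − t)u)) = −∂ₜ((1 − t) g(t + (1 − t)u))`, `t = s/2`). So with
`R = [[0,1]ⁿ⁺¹, ∂ₛΨ]` and `τ = (i last)`: `[R] − [r₁ + r₂ − r]` is Newton–Leibniz along `s`
(primitive `Ψ`), `[R] − [R.reindex τ]` is a symmetry, `[R.reindex τ] − [0]` is Newton–Leibniz along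
the new last coordinate `u` (primitive `V ∘ τ`), `−[0] = [0] − [0] − [0]`, `[r₁ + r₂] − [r₁] − [r₂]`
and `[r₁ + r₂] − [r] − [r₁ + r₂ − r]` are linearity generators. Analyticity near the closed cube and
`ℚ`-semialgebraicity on it of `Ψ`, `V`, `V ∘ τ` come from those of `g` (compositions with polynomial
self-maps of the cube); for `∂ₛΨ` they are `stokesCal_isSemialgebraicFunOn_fderiv_last`
(Basu–Pollack–Roy Prop. 3.22 on the cube with open last coordinate, then closure of the graph).

References: J. Ayoub, *Periods and the conjectures of Grothendieck and Kontsevich–Zagier*, EMS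
Newsl. 91 (2014), Def. 10; M. Kontsevich, D. Zagier, *Periods* (2001), §1.2 rules (1)–(3);
S. Basu, R. Pollack, M.-F. Roy, *Algorithms in Real Algebraic Geometry* (2006), Prop. 3.22.
-/

noncomputable section

namespace Summit.KontsevichZagierPeriods.FurushoPentagon.ReducedPeriodRing.LinStokesSym

open Set MeasureTheory
open Literature.NumberTheory.Transcendental
open Literature.NumberTheory.Transcendental.KZ
open Summit.KontsevichZagierPeriods.FurushoPentagon.SectorToKernel

/-- The subdivision homotopy `Ψ(x, s) = (s/2)·g(x with xᵢ ↦ (s/2)xᵢ) +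
(1 − s/2)·g(x with xᵢ ↦ s/2 + (1 − s/2)xᵢ) − g(x)` on `ℝⁿ⁺¹ ∋ (x, s)` (file-local notation). -/
local notation3 (prettyPrint := false) "Ψ[" n ", " g ", " i "]" => fun w : Fin (n + 1) → ℝ =>
  w (Fin.last n) / 2 *
        g (Function.update (Fin.init w) i (w (Fin.last n) / 2 * w (Fin.castSucc i))) +
    (1 - w (Fin.last n) / 2) * g (Function.update (Fin.init w) i
      (w (Fin.last n) / 2 + (1 - w (Fin.last n) / 2) * w (Fin.castSucc i))) - g (Fin.init w)

/-- The subdivision potential `V(x, s) = ½ (xᵢ·g(x with xᵢ ↦ (s/2)xᵢ) −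
(xᵢ − 1)·g(x with xᵢ ↦ s/2 + (1 − s/2)xᵢ))` (file-local notation): `∂ᵢV = ∂ₛΨ`,
`V|_{xᵢ=1} = V|_{xᵢ=0}`. -/
local notation3 (prettyPrint := false) "V[" n ", " g ", " i "]" => fun w : Fin (n + 1) → ℝ =>
  1 / 2 * (w (Fin.castSucc i) *
      g (Function.update (Fin.init w) i (w (Fin.last n) / 2 * w (Fin.castSucc i))) -
    (w (Fin.castSucc i) - 1) * g (Function.update (Fin.init w) i
      (w (Fin.last n) / 2 + (1 - w (Fin.last n) / 2) * w (Fin.castSucc i))))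

namespace SubdivGeneration

variable {n : ℕ} {g : (Fin n → ℝ) → ℝ} {i : Fin n} {Ψ V : (Fin (n + 1) → ℝ) → ℝ}

/-- `Ψ` on a slice `s ↦ (x, s)`. [folklore] -/
theorem homotopy_snoc (hΨ : Ψ = Ψ[n, g, i]) (x : Fin n → ℝ) (s : ℝ) :
    Ψ (Fin.snoc x s) = s / 2 * g (Function.update x i (s / 2 * x i)) +
      (1 - s / 2) * g (Function.update x i (s / 2 + (1 - s / 2) * x i)) - g x := by
  simp [hΨ, Fin.init_snoc, Fin.snoc_last, Fin.snoc_castSucc]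

/-- `V` on a slice `s ↦ (x, s)`. [folklore] -/
theorem potential_snoc (hV : V = V[n, g, i]) (x : Fin n → ℝ) (s : ℝ) :
    V (Fin.snoc x s) = 1 / 2 * (x i * g (Function.update x i (s / 2 * x i)) -
      (x i - 1) * g (Function.update x i (s / 2 + (1 - s / 2) * x i))) := by
  simp [hV, Fin.init_snoc, Fin.snoc_last, Fin.snoc_castSucc]

/-- Arguments of the lower contraction stay in the cube. [folklore] -/
theorem update_lower_mem_cube {y : Fin n → ℝ} (hy : y ∈ cube n) (i : Fin n) {s t : ℝ}
    (hs : s ∈ Icc (0 : ℝ) 1) (ht : t ∈ Icc (0 : ℝ) 1) : Function.update y i (s / 2 * t) ∈ cube n :=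
  update_mem_cube hy i (by nlinarith [hs.1, ht.1]) (by nlinarith [hs.1, hs.2, ht.1, ht.2])

/-- Arguments of the upper contraction stay in the cube. [folklore] -/
theorem update_upper_mem_cube {y : Fin n → ℝ} (hy : y ∈ cube n) (i : Fin n) {s t : ℝ}
    (hs : s ∈ Icc (0 : ℝ) 1) (ht : t ∈ Icc (0 : ℝ) 1) :
    Function.update y i (s / 2 + (1 - s / 2) * t) ∈ cube n :=
  update_mem_cube hy i (by nlinarith [hs.1, hs.2, ht.1]) (by nlinarith [hs.1, hs.2, ht.1, ht.2])

/-- Coordinate functions are analytic. [folklore] -/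
theorem analyticOnNhd_apply (m : ℕ) (j : Fin m) (s : Set (Fin m → ℝ)) :
    AnalyticOnNhd ℝ (fun w : Fin m → ℝ => w j) s :=
  ((ContinuousLinearMap.proj (R := ℝ) (φ := fun _ : Fin m => ℝ) j).analyticOnNhd _).mono
    (subset_univ _)

/-- **Side conditions.** For `g` analytic near `[0,1]ⁿ` and `ℚ`-semialgebraic on it, `Ψ` and `V`
are analytic near `[0,1]ⁿ⁺¹` and `ℚ`-semialgebraic on it: compositions of `g` with polynomial maps
over `ℚ` sending the cube into the cube, times polynomials. [Bochnak–Coste–Roy 1998, Prop. 2.2.6] -/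
theorem sideConditions (hga : AnalyticOnNhd ℝ g (cube n)) (hgs : IsSemialgebraicFunOn ℚ (cube n) g)
    (hΨ : Ψ = Ψ[n, g, i]) (hV : V = V[n, g, i]) :
    (AnalyticOnNhd ℝ Ψ (cube (n + 1)) ∧ IsSemialgebraicFunOn ℚ (cube (n + 1)) Ψ) ∧
      (AnalyticOnNhd ℝ V (cube (n + 1)) ∧ IsSemialgebraicFunOn ℚ (cube (n + 1)) V) := by
  have hX : ∀ j : Fin (n + 1), AnalyticOnNhd ℝ (fun w : Fin (n + 1) → ℝ => w j) (cube (n + 1)) :=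
    fun j => analyticOnNhd_apply _ j _
  have hXs : ∀ j : Fin (n + 1),
      IsSemialgebraicFunOn ℚ (cube (n + 1)) (fun w : Fin (n + 1) → ℝ => w j) :=
    fun j => isSemialgebraicFunOn_apply isSemialgebraic_cube j
  have h1s : IsSemialgebraicFunOn ℚ (cube (n + 1)) (fun _ : Fin (n + 1) → ℝ => (1 : ℝ)) := by
    simpa using isSemialgebraicFunOn_ratCast (isSemialgebraic_cube (n := n + 1)) 1
  have h2s : IsSemialgebraicFunOn ℚ (cube (n + 1)) (fun _ : Fin (n + 1) → ℝ => (1 / 2 : ℝ)) := by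
    simpa using isSemialgebraicFunOn_ratCast (isSemialgebraic_cube (n := n + 1)) (1 / 2)
  have hHs : IsSemialgebraicFunOn ℚ (cube (n + 1))
      (fun w : Fin (n + 1) → ℝ => w (Fin.last n) / 2) :=
    ((hXs _).fun_mul h2s).congr fun w _ => by ring
  -- the coefficients `a = (s/2)u`, `b = s/2 + (1 − s/2)u` of the two contractions
  have haa : AnalyticOnNhd ℝ (fun w : Fin (n + 1) → ℝ => w (Fin.last n) / 2 * w (Fin.castSucc i))
      (cube (n + 1)) := (hX _).div_const.mul (hX _)
  have hba : AnalyticOnNhd ℝ (fun w : Fin (n + 1) → ℝ =>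
      w (Fin.last n) / 2 + (1 - w (Fin.last n) / 2) * w (Fin.castSucc i)) (cube (n + 1)) :=
    (hX _).div_const.add ((analyticOnNhd_const.sub (hX _).div_const).mul (hX _))
  -- the compositions `g ∘ A`, `g ∘ B`, `g ∘ init`
  have hcomp : ∀ p : (Fin (n + 1) → ℝ) → ℝ, AnalyticOnNhd ℝ p (cube (n + 1)) →
      IsSemialgebraicFunOn ℚ (cube (n + 1)) p → (∀ w ∈ cube (n + 1), 0 ≤ p w ∧ p w ≤ 1) →
      AnalyticOnNhd ℝ (fun w => g (Function.update (Fin.init w) i (p w))) (cube (n + 1)) ∧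
        IsSemialgebraicFunOn ℚ (cube (n + 1))
          (fun w => g (Function.update (Fin.init w) i (p w))) := by
    intro p hpa hps hp
    have hmaps : MapsTo (fun w : Fin (n + 1) → ℝ => Function.update (Fin.init w) i (p w))
        (cube (n + 1)) (cube n) :=
      fun w hw => update_mem_cube (fun j => hw (Fin.castSucc j)) i (hp w hw).1 (hp w hw).2
    refine ⟨hga.comp (AnalyticOnNhd.pi fun j => ?_) hmaps,
      IsSemialgebraicFunOn.comp_isSemialgebraicMapOn_holds hgs
        (IsSemialgebraicMapOn.of_forall isSemialgebraic_cube fun j => ?_) hmaps⟩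
    · rcases eq_or_ne j i with rfl | hj
      · simpa only [Function.update_self] using hpa
      · simp only [Function.update_of_ne hj]; exact hX (Fin.castSucc j)
    · rcases eq_or_ne j i with rfl | hj
      · simpa only [Function.update_self] using hps
      · simp only [Function.update_of_ne hj]; exact hXs (Fin.castSucc j)
  obtain ⟨hAa, hAs⟩ := hcomp _ haa (hHs.fun_mul (hXs _)) fun w hw =>
    ⟨mul_nonneg (by linarith [(hw (Fin.last n)).1]) (hw _).1,
      by nlinarith [(hw (Fin.last n)).1, (hw (Fin.last n)).2, (hw (Fin.castSucc i)).1,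
        (hw (Fin.castSucc i)).2]⟩
  obtain ⟨hBa, hBs⟩ := hcomp _ hba (hHs.fun_add ((h1s.fun_sub hHs).fun_mul (hXs _))) fun w hw =>
    ⟨by nlinarith [(hw (Fin.last n)).1, (hw (Fin.last n)).2, (hw (Fin.castSucc i)).1],
      by nlinarith [(hw (Fin.last n)).1, (hw (Fin.last n)).2, (hw (Fin.castSucc i)).1,
        (hw (Fin.castSucc i)).2]⟩
  have hCa : AnalyticOnNhd ℝ (fun w : Fin (n + 1) → ℝ => g (Fin.init w)) (cube (n + 1)) :=
    hga.comp (AnalyticOnNhd.pi fun j => hX (Fin.castSucc j)) fun w hw j => hw (Fin.castSucc j)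
  have hCs : IsSemialgebraicFunOn ℚ (cube (n + 1)) (fun w : Fin (n + 1) → ℝ => g (Fin.init w)) :=
    hgs.comp_init_mono isSemialgebraic_cube fun w hw j => hw (Fin.castSucc j)
  subst hΨ hV
  exact ⟨⟨(((hX _).div_const.mul hAa).add ((analyticOnNhd_const.sub (hX _).div_const).mul hBa)).sub
      hCa, ((hHs.fun_mul hAs).fun_add ((h1s.fun_sub hHs).fun_mul hBs)).fun_sub hCs⟩,
    analyticOnNhd_const.mul (((hX _).mul hAa).sub (((hX _).sub analyticOnNhd_const).mul hBa)),
    h2s.fun_mul (((hXs _).fun_mul hAs).fun_sub (((hXs _).fun_sub h1s).fun_mul hBs))⟩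

/-! ### Coordinate permutations -/

/-- The cube is invariant under coordinate permutations. [folklore] -/
theorem setOf_comp_perm_mem_cube {m : ℕ} (σ : Equiv.Perm (Fin m)) :
    {w : Fin m → ℝ | (fun j => w (σ j)) ∈ cube m} = cube m := by
  ext w
  simp only [mem_setOf_eq, mem_cube]
  exact ⟨fun h j => by simpa using h (σ.symm j), fun h j => h (σ j)⟩

/-- Analyticity near the cube is invariant under coordinate permutations. [folklore] -/
theorem analyticOnNhd_comp_perm {m : ℕ} {f : (Fin m → ℝ) → ℝ} (hf : AnalyticOnNhd ℝ f (cube m))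
    (σ : Equiv.Perm (Fin m)) :
    AnalyticOnNhd ℝ (fun w : Fin m → ℝ => f (fun j => w (σ j))) (cube m) :=
  hf.comp (AnalyticOnNhd.pi fun j => analyticOnNhd_apply m (σ j) _) fun _ hw j => hw (σ j)

/-- `ℚ`-semialgebraicity on the cube is invariant under coordinate permutations.
[Bochnak–Coste–Roy 1998, §2.2] -/
theorem isSemialgebraicFunOn_comp_perm {m : ℕ} {f : (Fin m → ℝ) → ℝ}
    (hf : IsSemialgebraicFunOn ℚ (cube m) f) (σ : Equiv.Perm (Fin m)) :
    IsSemialgebraicFunOn ℚ (cube m) (fun w : Fin m → ℝ => f (fun j => w (σ j))) := by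
  simpa only [setOf_comp_perm_mem_cube] using hf.comp_equiv σ

/-- The coordinate permutation of a tame cube is a tame cube. [Ayoub 2014, Def. 10] -/
theorem isTameCube_reindex {m : ℕ} {R : IntegralRep m} (hR : R.IsTameCube)
    (σ : Equiv.Perm (Fin m)) : (R.reindex σ).IsTameCube := by
  refine ⟨by rw [IntegralRep.reindex_domain, hR.1, setOf_comp_perm_mem_cube], ?_⟩
  rw [IntegralRep.reindex_integrand]
  exact analyticOnNhd_comp_perm hR.2 σ

/-- The transposition `(i last)` on slices: `s ↦ (y, s) ∘ (i last)` is `s ↦ ((y with yᵢ ↦ s), yᵢ)`.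
[folklore] -/
theorem comp_swap_snoc (i : Fin n) (y : Fin n → ℝ) (a : ℝ) :
    (fun j => (Fin.snoc y a : Fin (n + 1) → ℝ) (Equiv.swap (Fin.castSucc i) (Fin.last n) j)) =
      Fin.snoc (Function.update y i a) (y i) := by
  funext j
  induction j using Fin.lastCases with
  | last => simp [Equiv.swap_apply_right]
  | cast j =>
    rcases eq_or_ne j i with rfl | hj
    · simp [Equiv.swap_apply_left]
    · rw [Equiv.swap_apply_of_ne_of_ne (fun h => hj (Fin.castSucc_injective _ h))
        (Fin.castSucc_lt_last j).ne]
      simp [Function.update_of_ne hj]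

/-! ### The calculus identity `∂ₛΨ = ∂ᵤV` -/

/-- The slice `a ↦ g(x with xᵢ ↦ a)` of a differentiable function has derivative `∂ᵢ g`.
[folklore] -/
theorem hasDerivAt_update_slice {g : (Fin n → ℝ) → ℝ} {x : Fin n → ℝ} {i : Fin n} {a : ℝ}
    (hg : DifferentiableAt ℝ g (Function.update x i a)) :
    HasDerivAt (fun b => g (Function.update x i b))
      (fderiv ℝ g (Function.update x i a) (Pi.single i 1)) a :=
  hg.hasFDerivAt.comp_hasDerivAt a (hasDerivAt_update x i a)

/-- **The calculus identity `∂ₛΨ = ∂ᵤV`, transposed.** For `y ∈ [0,1]ⁿ` and `t ∈ [0,1]` the slice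
`a ↦ V((y with yᵢ ↦ a), yᵢ)` has derivative at `a = t` the last partial derivative of `Ψ` at the
transposed point `((y with yᵢ ↦ t), yᵢ)`. With `s = yᵢ`, `h(a) = g(y with yᵢ ↦ a)`,
`a₁ = (s/2)t`, `a₂ = s/2 + (1 − s/2)t`, both equal
`½ h(a₁) + (st/4) h′(a₁) − ½ h(a₂) + ½ (1 − t)(1 − s/2) h′(a₂)` (product and chain rules; the
value of `∂ₛΨ` by uniqueness of derivatives). [folklore] -/
theorem hasDerivAt_potential_swap (hg : AnalyticOnNhd ℝ g (cube n)) (hΨ : Ψ = Ψ[n, g, i])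
    (hV : V = V[n, g, i]) (hΨa : AnalyticOnNhd ℝ Ψ (cube (n + 1))) {y : Fin n → ℝ}
    (hy : y ∈ cube n) {t : ℝ} (ht : t ∈ Icc (0 : ℝ) 1) :
    HasDerivAt (fun a : ℝ => V (Fin.snoc (Function.update y i a) (y i)))
      (fderiv ℝ Ψ (Fin.snoc (Function.update y i t) (y i)) (Pi.single (Fin.last n) 1)) t := by
  have hs : y i ∈ Icc (0 : ℝ) 1 := ⟨(hy i).1, (hy i).2⟩
  have hd₁ : DifferentiableAt ℝ g (Function.update y i (y i / 2 * t)) :=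
    (hg _ (update_lower_mem_cube hy i hs ht)).differentiableAt
  have hd₂ : DifferentiableAt ℝ g (Function.update y i (y i / 2 + (1 - y i / 2) * t)) :=
    (hg _ (update_upper_mem_cube hy i hs ht)).differentiableAt
  -- `∂ₛΨ` at the transposed point `(x, s) = ((y with yᵢ ↦ t), yᵢ)`, `s = yᵢ`
  set x : Fin n → ℝ := Function.update y i t with hx_def
  have hxi : x i = t := by simp [hx_def]
  have hupd : ∀ c : ℝ, Function.update x i c = Function.update y i c := fun c => by
    simp [hx_def, Function.update_idem]
  have hw : (Fin.snoc x (y i) : Fin (n + 1) → ℝ) ∈ cube (n + 1) :=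
    snoc_mem_cube_iff.2 ⟨update_mem_cube hy i ht.1 ht.2, hs.1, hs.2⟩
  have hl : HasDerivAt (fun σ : ℝ => σ / 2) (1 / 2) (y i) := by
    simpa using (hasDerivAt_id (y i)).div_const 2
  have ha₂ : HasDerivAt (fun σ : ℝ => σ / 2 + (1 - σ / 2) * t) (1 / 2 + (0 - 1 / 2) * t) (y i) :=
    hl.fun_add (((hasDerivAt_const (y i) (1 : ℝ)).fun_sub hl).mul_const t)
  have hg₁ : HasDerivAt (fun σ : ℝ => g (Function.update y i (σ / 2 * t)))
      (fderiv ℝ g (Function.update y i (y i / 2 * t)) (Pi.single i 1) * (1 / 2 * t)) (y i) :=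
    ((hasDerivAt_update_slice hd₁).comp (y i) (hl.mul_const t) :)
  have hg₂ : HasDerivAt (fun σ : ℝ => g (Function.update y i (σ / 2 + (1 - σ / 2) * t)))
      (fderiv ℝ g (Function.update y i (y i / 2 + (1 - y i / 2) * t)) (Pi.single i 1) *
        (1 / 2 + (0 - 1 / 2) * t)) (y i) :=
    ((hasDerivAt_update_slice hd₂).comp (y i) ha₂ :)
  have hΨ' := ((hl.fun_mul hg₁).fun_add (((hasDerivAt_const (y i) (1 : ℝ)).fun_sub hl).fun_mul
    hg₂)).sub_const (g x)
  have hΨx := stokesCal_hasDerivAt_snoc ((hΨa _ hw).differentiableAt)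
  have hfunΨ : (fun σ : ℝ => Ψ (Fin.snoc x σ)) = fun σ =>
      σ / 2 * g (Function.update y i (σ / 2 * t)) +
        (1 - σ / 2) * g (Function.update y i (σ / 2 + (1 - σ / 2) * t)) - g x :=
    funext fun σ => by simp only [homotopy_snoc hΨ, hxi, hupd]
  rw [hfunΨ] at hΨx
  rw [hΨx.unique hΨ']
  -- `∂ᵤV` on the slice `a ↦ ((y with yᵢ ↦ a), s)`
  have hfun : (fun a : ℝ => V (Fin.snoc (Function.update y i a) (y i))) =
      fun a => 1 / 2 * (a * g (Function.update y i (y i / 2 * a)) -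
        (a - 1) * g (Function.update y i (y i / 2 + (1 - y i / 2) * a))) := by
    funext a
    rw [potential_snoc hV]
    simp [Function.update_idem]
  rw [hfun]
  have hb₁ : HasDerivAt (fun a : ℝ => y i / 2 * a) (y i / 2) t := by
    simpa using (hasDerivAt_id t).const_mul (y i / 2)
  have hb₂ : HasDerivAt (fun a : ℝ => y i / 2 + (1 - y i / 2) * a) (1 - y i / 2) t := by
    simpa using ((hasDerivAt_id t).const_mul (1 - y i / 2)).const_add (y i / 2)
  have hV₁ : HasDerivAt (fun a : ℝ => g (Function.update y i (y i / 2 * a)))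
      (fderiv ℝ g (Function.update y i (y i / 2 * t)) (Pi.single i 1) * (y i / 2)) t :=
    ((hasDerivAt_update_slice hd₁).comp t hb₁ :)
  have hV₂ : HasDerivAt (fun a : ℝ => g (Function.update y i (y i / 2 + (1 - y i / 2) * a)))
      (fderiv ℝ g (Function.update y i (y i / 2 + (1 - y i / 2) * t)) (Pi.single i 1) *
        (1 - y i / 2)) t :=
    ((hasDerivAt_update_slice hd₂).comp t hb₂ :)
  have key := (((hasDerivAt_id' t).fun_mul hV₁).fun_sub
    (((hasDerivAt_id' t).sub_const (1 : ℝ)).fun_mul hV₂)).const_mul (1 / 2 : ℝ)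
  exact key.congr_deriv (by ring)

/-- A tame cube with integrand `0` on the cube lies in `linStokesSymIdeal`
(`−[R] = [R] − [R] − [R] ∈ Lin`). [Kontsevich–Zagier 2001, §1.2 rule (1)] -/
theorem of_mem_of_integrand_zero {m : ℕ} {R : IntegralRep m} (hR : R.IsTameCube)
    (h0 : ∀ x ∈ cube m, R.integrand x = 0) : of R ∈ linStokesSymIdeal := by
  have h := cubicalLinGens_subset_linStokesSymIdeal (mem_cubicalLinGens hR hR hR fun x hx => by
    simp [h0 x hx])
  rw [show of R = -(of R - of R - of R) by abel]
  exact linStokesSymIdeal.neg_mem h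

/-- **Dyadic subdivision from Lin + StokesLast + Sym.** For tame cubes `r, r₁, r₂` with
`r₁ = ½ r(· with xᵢ ↦ xᵢ/2)`, `r₂ = ½ r(· with xᵢ ↦ (1 + xᵢ)/2)` on the cube,
`[r] − [r₁] − [r₂] ∈ linStokesSymIdeal`: with `R = [[0,1]ⁿ⁺¹, ∂ₛΨ]`, `R' = [r₁ + r₂ − r]`,
`R₁₂ = [r₁ + r₂]`, `R₀ = [0]` and `τ = (i last)`, it is `([R₁₂] − [r₁] − [r₂]) − ([R₁₂] − [r] − [R'])
− (([R] − [R.reindex τ]) + ([R.reindex τ] − [R₀]) + [R₀] − ([R] − [R']))` (Lin, Lin, Sym, StokesLast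
with primitive `V ∘ τ`, Lin, StokesLast with primitive `Ψ`).
[Ayoub 2014, Def. 10; Kontsevich–Zagier 2001, §1.2 rules (1)–(3)] -/
theorem of_sub_of_sub_of_mem {r r₁ r₂ : IntegralRep n} (i : Fin n) (hr : r.IsTameCube)
    (h₁ : r₁.IsTameCube) (h₂ : r₂.IsTameCube)
    (hf₁ : ∀ x ∈ cube n, r₁.integrand x = (1 / 2 : ℝ) * r.integrand (Function.update x i (x i / 2)))
    (hf₂ : ∀ x ∈ cube n,
      r₂.integrand x = (1 / 2 : ℝ) * r.integrand (Function.update x i ((1 + x i) / 2))) :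
    of r - of r₁ - of r₂ ∈ linStokesSymIdeal := by
  obtain ⟨Ψ, hΨ⟩ : ∃ Ψ : (Fin (n + 1) → ℝ) → ℝ, Ψ = Ψ[n, r.integrand, i] := ⟨_, rfl⟩
  obtain ⟨V, hV⟩ : ∃ V : (Fin (n + 1) → ℝ) → ℝ, V = V[n, r.integrand, i] := ⟨_, rfl⟩
  obtain ⟨⟨hΨa, hΨs⟩, hVa, hVs⟩ := sideConditions hr.2 hr.isSemialgebraicFunOn hΨ hV
  -- `R = [[0,1]ⁿ⁺¹, ∂ₛΨ]`, `R' = [r₁ + r₂ − r]`, `R₁₂ = [r₁ + r₂]`, `R₀ = [0]`, `τ = (i last)`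
  have hΨ'a := stokesCal_analyticOnNhd_fderiv_apply hΨa (Pi.single (Fin.last n) 1)
  obtain ⟨R, hRd, hRi⟩ : ∃ R : IntegralRep (n + 1), R.domain = cube (n + 1) ∧ R.integrand =
      fun w => fderiv ℝ Ψ w (Pi.single (Fin.last n) 1) :=
    ⟨IntegralRep.tameCube _ hΨ'a (stokesCal_isSemialgebraicFunOn_fderiv_last hΨa hΨs), rfl, rfl⟩
  have hRt : R.IsTameCube := ⟨hRd, by rw [hRi]; exact hΨ'a⟩
  have hDa : AnalyticOnNhd ℝ (fun x => r₁.integrand x + r₂.integrand x - r.integrand x) (cube n) :=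
    (h₁.2.add h₂.2).sub hr.2
  obtain ⟨R', hR'd, hR'i⟩ : ∃ S : IntegralRep n, S.domain = cube n ∧
      S.integrand = fun x => r₁.integrand x + r₂.integrand x - r.integrand x :=
    ⟨IntegralRep.tameCube _ hDa ((h₁.isSemialgebraicFunOn.fun_add h₂.isSemialgebraicFunOn).fun_sub
      hr.isSemialgebraicFunOn), rfl, rfl⟩
  have hR't : R'.IsTameCube := ⟨hR'd, by rw [hR'i]; exact hDa⟩
  obtain ⟨R₁₂, h12d, h12i⟩ : ∃ S : IntegralRep n, S.domain = cube n ∧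
      S.integrand = fun x => r₁.integrand x + r₂.integrand x :=
    ⟨IntegralRep.tameCube _ (h₁.2.add h₂.2)
      (h₁.isSemialgebraicFunOn.fun_add h₂.isSemialgebraicFunOn), rfl, rfl⟩
  have h12t : R₁₂.IsTameCube := ⟨h12d, by rw [h12i]; exact h₁.2.add h₂.2⟩
  obtain ⟨R₀, hR₀d, hR₀i⟩ := exists_zeroRep (σ := cube n) isSemialgebraic_cube
  have hR₀t : R₀.IsTameCube := ⟨hR₀d, by rw [hR₀i]; exact analyticOnNhd_const⟩
  obtain ⟨τ, hτ⟩ : ∃ τ : Equiv.Perm (Fin (n + 1)), τ = Equiv.swap (Fin.castSucc i) (Fin.last n) :=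
    ⟨_, rfl⟩
  -- StokesLast with primitive `Ψ`: `[R] − [R']`
  have hA : of R - of R' ∈ linStokesSymIdeal := by
    refine cubicalStokesGens_subset_linStokesSymIdeal (mem_cubicalStokesGens hRt hR't hΨa hΨs
      (fun x hx t ht => ?_) fun x hx => ?_)
    · rw [hRi]
      exact stokesCal_hasDerivAt_snoc
        (hΨa _ (snoc_mem_cube_iff.2 ⟨hx, ht.1, ht.2⟩)).differentiableAt
    · have e₁ : (1 : ℝ) / 2 * x i = x i / 2 := by ring
      have e₂ : (1 : ℝ) / 2 + (1 - 1 / 2) * x i = (1 + x i) / 2 := by ring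
      simp only [hR'i, homotopy_snoc hΨ, hf₁ x hx, hf₂ x hx, e₁, e₂, zero_div, zero_mul, sub_zero,
        one_mul, zero_add, Function.update_eq_self]
      ring
  -- Sym: `[R] − [R.reindex τ]`; StokesLast with primitive `V ∘ τ`: `[R.reindex τ] − [R₀]`; `[R₀]`
  have hS := of_sub_of_reindex_mem_linStokesSymIdeal hRt τ
  have hB : of (R.reindex τ) - of R₀ ∈ linStokesSymIdeal := by
    refine cubicalStokesGens_subset_linStokesSymIdeal (mem_cubicalStokesGens
      (F := fun w : Fin (n + 1) → ℝ => V (fun j => w (τ j)))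
      (isTameCube_reindex hRt τ) hR₀t (analyticOnNhd_comp_perm hVa τ)
      (isSemialgebraicFunOn_comp_perm hVs τ) (fun y hy t ht => ?_) fun y _ => ?_)
    · have hfun : (fun s : ℝ => V (fun j => (Fin.snoc y s : Fin (n + 1) → ℝ) (τ j))) =
          fun s => V (Fin.snoc (Function.update y i s) (y i)) :=
        funext fun s => by rw [hτ, comp_swap_snoc]
      rw [hfun, IntegralRep.reindex_integrand, hRi]
      simp only
      rw [hτ, comp_swap_snoc]
      exact hasDerivAt_potential_swap hr.2 hΨ hV hΨa hy ht
    · simp only [hR₀i, Pi.zero_apply]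
      rw [hτ, comp_swap_snoc, comp_swap_snoc, potential_snoc hV, potential_snoc hV]
      simp
  have h₀ : of R₀ ∈ linStokesSymIdeal := of_mem_of_integrand_zero hR₀t fun x _ => by simp [hR₀i]
  -- Lin: `[R₁₂] − [r₁] − [r₂]`, `[R₁₂] − [r] − [R']`
  have hL₁ : of R₁₂ - of r₁ - of r₂ ∈ linStokesSymIdeal := cubicalLinGens_subset_linStokesSymIdeal
    (mem_cubicalLinGens h12t h₁ h₂ fun x _ => by rw [h12i, Pi.add_apply])
  have hL₂ : of R₁₂ - of r - of R' ∈ linStokesSymIdeal := cubicalLinGens_subset_linStokesSymIdeal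
    (mem_cubicalLinGens h12t hr hR't fun x _ => by rw [h12i, Pi.add_apply, hR'i]; ring)
  rw [show of r - of r₁ - of r₂ = (of R₁₂ - of r₁ - of r₂) - (of R₁₂ - of r - of R') -
    ((of R - of (R.reindex τ)) + (of (R.reindex τ) - of R₀) + of R₀ - (of R - of R')) by abel]
  exact linStokesSymIdeal.sub_mem (linStokesSymIdeal.sub_mem hL₁ hL₂)
    (linStokesSymIdeal.sub_mem (linStokesSymIdeal.add_mem (linStokesSymIdeal.add_mem hS hB) h₀) hA)

end SubdivGeneration

/-- **Stub `stub_subdivGeneration`** (crux stmt-KontsevichZagierPeriods-3929, line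
`lin-stokes-sym`): every dyadic subdivision generator `[r] − [r₁] − [r₂]` of the cubical calculus
(`KZ.cubicalSubdivGens`) lies in Ayoub's relation module with symmetries
`linStokesSymIdeal = closure (Lin ∪ StokesLast ∪ Sym)` (`SubdivGeneration.of_sub_of_sub_of_mem`).
[Ayoub 2014, Def. 10; Kontsevich–Zagier 2001, §1.2 rules (1)–(3)] -/
theorem stub_subdivGeneration : KZ.cubicalSubdivGens ⊆ (linStokesSymIdeal : Set FormalRep) := by
  rintro c ⟨n, r, r₁, r₂, i, hr, hra, hr₁, hr₁a, hr₂, hr₂a, hf₁, hf₂, rfl⟩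
  exact SubdivGeneration.of_sub_of_sub_of_mem i ⟨hr, hra⟩ ⟨hr₁, hr₁a⟩ ⟨hr₂, hr₂a⟩ hf₁ hf₂

end Summit.KontsevichZagierPeriods.FurushoPentagon.ReducedPeriodRing.LinStokesSym
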